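import Summits.CriticalPhenomena.PercolationContinuityZ3.Theorems.PercNearOneGluingNoHeavyLowerTailQ7PsiZDual
import HarnessLib

/-!
# `NoHeavyLowerTail` (stmt-CriticalPhenomena-4575) — four relays: the observer worlds and the one-owner duality

Support file (`--supports stmt-CriticalPhenomena-4575`), coupling seat `prim-cplus-coupling` (gen 9).  No definitions, no named
facts, no sorries.

Bookkeeping for the (GΨ₄) certificate (seat memo prim-cplus-coupling/Q7-FOUR-RELAYS.md §1): observer `o`, strong relays `x, y, u`,
weak relay `z`.  The event `J' = (o↔x ∪ o↔y ∪ o↔u) ∩ {o↮z}` is the disjoint union of the seven worlds "`C_o ∩ {x,y,u} = S`",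
each an event of the cluster of any owner `i ∈ S` (on it `C_o = C_i`).

* `Q7Psi.zquarter_of_oquarter` — duality for one owner: if the `x`-half
  `λ ∫_{x↮z} G(C x) ≤ ∫_{A} G(C x) + t₁ ∫_{B₁} G(C x) + t₂ ∫_{B₂} G(C x) + t₃ ∫_{T} G(C x)` holds for EVERY monotone `G`
  (`A, B₁, B₂, T` the four worlds containing `x`), then the same combination of `∫ F(C z)` is `≤ λ ∫_{x↮z} F(C z)` for every
  monotone `F` (conditioning on `C_x`: `Q7Psi.tower_weak`, `Q7Psi.condMean_antitone`);
* `Q7Psi.integral_sevenWorlds` — `∫_{J'} g = Σ_{seven worlds} ∫ g`;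
* `Q7Psi.integral_pairWorld_swap`, `…tripleWorld_swap`, `…_swap_u` (and primed versions) — a shared world read from two owners is
  the same event and the owners' clusters coincide on it.
[cite: KozmaNitzan2024, §5.1 (pp. 31–32), Question 7 (p. 36)] [cite: VandenbergHaggstromKahn2005, §2.1 Lemma 2.4 (p. 10)]
-/

namespace Summit.CriticalPhenomena.PercolationContinuityZ3.Theorems

open MeasureTheory Set Literature.Probability.LatticeModels Literature.Probability.Percolation
open scoped Classical
open KNPreFKG BHK2006

noncomputable section

namespace Q7Psi

variable {V : Type*} [Fintype V]

/-- **Duality for one owner of the four-relay certificate.**  If for every monotone `G`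
`λ ∫_{x↮z} G(C x) ≤ ∫_{A} G(C x) + t₁ ∫_{B₁} G(C x) + t₂ ∫_{B₂} G(C x) + t₃ ∫_{T} G(C x)` with the four `σ(C_x)`-worlds
`A = {x↔o,x↮y,x↮u,x↮z}`, `B₁ = {x↔o,x↔y,x↮u,x↮z}`, `B₂ = {x↔o,x↔u,x↮y,x↮z}`, `T = {x↔o,x↔y,x↔u,x↮z}`, then for every monotone `F`
`∫_{A} F(C z) + t₁ ∫_{B₁} F(C z) + t₂ ∫_{B₂} F(C z) + t₃ ∫_{T} F(C z) ≤ λ ∫_{x↮z} F(C z)`.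
[cite: VandenbergHaggstromKahn2005, §2.1 Lemma 2.4 (p. 10)] -/
theorem zquarter_of_oquarter (w : Sym2 V → unitInterval) (o x y u z : V) (F : Set V → ℝ)
    (hF : ∀ S T : Set V, S ⊆ T → F S ≤ F T) (t₁ t₂ t₃ lam : ℝ)
    (hP : ∀ G : Set V → ℝ, (∀ S T : Set V, S ⊆ T → G S ≤ G T) →
      lam * ∫ ω in {ω : BondConfig V | ¬ (openGraph ω).Reachable x z}, G (openCluster ω x) ∂(prodBernoulli w) ≤
        (∫ ω in openConn x o ∩ {ω | ¬ (openGraph ω).Reachable x y} ∩ {ω | ¬ (openGraph ω).Reachable x u} ∩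
            {ω | ¬ (openGraph ω).Reachable x z}, G (openCluster ω x) ∂(prodBernoulli w)) +
        t₁ * (∫ ω in openConn x o ∩ openConn x y ∩ {ω | ¬ (openGraph ω).Reachable x u} ∩
            {ω | ¬ (openGraph ω).Reachable x z}, G (openCluster ω x) ∂(prodBernoulli w)) +
        t₂ * (∫ ω in openConn x o ∩ openConn x u ∩ {ω | ¬ (openGraph ω).Reachable x y} ∩
            {ω | ¬ (openGraph ω).Reachable x z}, G (openCluster ω x) ∂(prodBernoulli w)) +
        t₃ * (∫ ω in openConn x o ∩ openConn x y ∩ openConn x u ∩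
            {ω | ¬ (openGraph ω).Reachable x z}, G (openCluster ω x) ∂(prodBernoulli w))) :
    (∫ ω in openConn x o ∩ {ω | ¬ (openGraph ω).Reachable x y} ∩ {ω | ¬ (openGraph ω).Reachable x u} ∩
          {ω | ¬ (openGraph ω).Reachable x z}, F (openCluster ω z) ∂(prodBernoulli w)) +
      t₁ * (∫ ω in openConn x o ∩ openConn x y ∩ {ω | ¬ (openGraph ω).Reachable x u} ∩
          {ω | ¬ (openGraph ω).Reachable x z}, F (openCluster ω z) ∂(prodBernoulli w)) +
      t₂ * (∫ ω in openConn x o ∩ openConn x u ∩ {ω | ¬ (openGraph ω).Reachable x y} ∩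
          {ω | ¬ (openGraph ω).Reachable x z}, F (openCluster ω z) ∂(prodBernoulli w)) +
      t₃ * (∫ ω in openConn x o ∩ openConn x y ∩ openConn x u ∩
          {ω | ¬ (openGraph ω).Reachable x z}, F (openCluster ω z) ∂(prodBernoulli w)) ≤
      lam * ∫ ω in {ω : BondConfig V | ¬ (openGraph ω).Reachable x z}, F (openCluster ω z) ∂(prodBernoulli w) := by
  classical
  set μ := prodBernoulli w with hμ
  set D : Set (BondConfig V) := {ω | ¬ (openGraph ω).Reachable x z} with hD
  set G : Set V → ℝ := fun S => - ∫ η, F (openCluster (η \ {e : Sym2 V | ∃ v ∈ e, v ∈ S}) z) ∂μ with hG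
  have hGmono : ∀ S T : Set V, S ⊆ T → G S ≤ G T := fun S T hST =>
    neg_le_neg (condMean_antitone w z F hF S T hST)
  have key := hP G hGmono
  -- the four worlds as `σ(C_x)`-events inside `D`
  set Po : Set (Sym2 V) → Prop := fun K => o = x ∨ ∃ e ∈ K, o ∈ e with hPo
  set Py : Set (Sym2 V) → Prop := fun K => y = x ∨ ∃ e ∈ K, y ∈ e with hPy
  set Pu : Set (Sym2 V) → Prop := fun K => u = x ∨ ∃ e ∈ K, u ∈ e with hPu
  set 𝒜 : Set (Set (Sym2 V)) := {K | Po K ∧ ¬ Py K ∧ ¬ Pu K} with h𝒜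
  set ℬ₁ : Set (Set (Sym2 V)) := {K | Po K ∧ Py K ∧ ¬ Pu K} with hℬ₁
  set ℬ₂ : Set (Set (Sym2 V)) := {K | Po K ∧ Pu K ∧ ¬ Py K} with hℬ₂
  set 𝒯 : Set (Set (Sym2 V)) := {K | Po K ∧ Py K ∧ Pu K} with h𝒯
  have ro : ∀ ω : BondConfig V, (openGraph ω).Reachable x o ↔ Po (openEdgeCluster ω x) :=
    fun ω => reachable_iff_exists_mem_openEdgeCluster ω x o
  have ry : ∀ ω : BondConfig V, (openGraph ω).Reachable x y ↔ Py (openEdgeCluster ω x) :=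
    fun ω => reachable_iff_exists_mem_openEdgeCluster ω x y
  have ru : ∀ ω : BondConfig V, (openGraph ω).Reachable x u ↔ Pu (openEdgeCluster ω x) :=
    fun ω => reachable_iff_exists_mem_openEdgeCluster ω x u
  have hE0 : D = D ∩ {ω | openEdgeCluster ω x ∈ (univ : Set (Set (Sym2 V)))} := by simp
  have hEA : openConn x o ∩ {ω | ¬ (openGraph ω).Reachable x y} ∩ {ω | ¬ (openGraph ω).Reachable x u} ∩ D =
      D ∩ {ω | openEdgeCluster ω x ∈ 𝒜} := by
    ext ω; simp only [mem_inter_iff, openConn, mem_setOf_eq, h𝒜, ro ω, ry ω, ru ω]; tauto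
  have hEB1 : openConn x o ∩ openConn x y ∩ {ω | ¬ (openGraph ω).Reachable x u} ∩ D =
      D ∩ {ω | openEdgeCluster ω x ∈ ℬ₁} := by
    ext ω; simp only [mem_inter_iff, openConn, mem_setOf_eq, hℬ₁, ro ω, ry ω, ru ω]; tauto
  have hEB2 : openConn x o ∩ openConn x u ∩ {ω | ¬ (openGraph ω).Reachable x y} ∩ D =
      D ∩ {ω | openEdgeCluster ω x ∈ ℬ₂} := by
    ext ω; simp only [mem_inter_iff, openConn, mem_setOf_eq, hℬ₂, ro ω, ry ω, ru ω]; tauto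
  have hET : openConn x o ∩ openConn x y ∩ openConn x u ∩ D = D ∩ {ω | openEdgeCluster ω x ∈ 𝒯} := by
    ext ω; simp only [mem_inter_iff, openConn, mem_setOf_eq, h𝒯, ro ω, ry ω, ru ω]; tauto
  have hTow : ∀ 𝒮 : Set (Set (Sym2 V)),
      ∫ ω in D ∩ {ω | openEdgeCluster ω x ∈ 𝒮}, F (openCluster ω z) ∂μ =
        - ∫ ω in D ∩ {ω | openEdgeCluster ω x ∈ 𝒮}, G (openCluster ω x) ∂μ := by
    intro 𝒮
    rw [hμ, hD, tower_weak w x z F 𝒮, ← integral_neg]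
    refine setIntegral_congr_fun MeasurableSet.of_discrete fun ω _ => ?_
    simp only [hG, neg_neg, hμ]
  have i0 : ∫ ω in D, F (openCluster ω z) ∂μ = - ∫ ω in D, G (openCluster ω x) ∂μ := by
    have h := hTow univ; rwa [← hE0] at h
  have iA := hTow 𝒜; rw [← hEA] at iA
  have iB1 := hTow ℬ₁; rw [← hEB1] at iB1
  have iB2 := hTow ℬ₂; rw [← hEB2] at iB2
  have iT := hTow 𝒯; rw [← hET] at iT
  rw [i0, iA, iB1, iB2, iT]
  linarith [key]

/-- **The seven observer worlds.**  `J' = (o↔x ∪ o↔y ∪ o↔u) ∩ {o↮z}` is the disjoint union of the worlds "`C_o ∩ {x,y,u} = S`",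
`S ≠ ∅`, each written as an event of one owner in `S`; hence every integral over `J'` splits into seven.
[cite: KozmaNitzan2024, §5.1 (pp. 31–32)] -/
theorem integral_sevenWorlds (w : Sym2 V → unitInterval) (o x y u z : V) (g : BondConfig V → ℝ) :
    ∫ ω in (openConn o x ∪ openConn o y ∪ openConn o u) ∩ {ω | ¬ (openGraph ω).Reachable o z}, g ω ∂(prodBernoulli w) =
      (∫ ω in (openConn x o ∩ {ω | ¬ (openGraph ω).Reachable x y} ∩ {ω | ¬ (openGraph ω).Reachable x u} ∩ {ω | ¬ (openGraph ω).Reachable x z}), g ω ∂(prodBernoulli w)) + (∫ ω in (openConn y o ∩ {ω | ¬ (openGraph ω).Reachable y x} ∩ {ω | ¬ (openGraph ω).Reachable y u} ∩ {ω | ¬ (openGraph ω).Reachable y z}), g ω ∂(prodBernoulli w)) + (∫ ω in (openConn u o ∩ {ω | ¬ (openGraph ω).Reachable u x} ∩ {ω | ¬ (openGraph ω).Reachable u y} ∩ {ω | ¬ (openGraph ω).Reachable u z}), g ω ∂(prodBernoulli w)) +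
      (∫ ω in (openConn x o ∩ openConn x y ∩ {ω | ¬ (openGraph ω).Reachable x u} ∩ {ω | ¬ (openGraph ω).Reachable x z}), g ω ∂(prodBernoulli w)) + (∫ ω in (openConn x o ∩ openConn x u ∩ {ω | ¬ (openGraph ω).Reachable x y} ∩ {ω | ¬ (openGraph ω).Reachable x z}), g ω ∂(prodBernoulli w)) + (∫ ω in (openConn y o ∩ openConn y u ∩ {ω | ¬ (openGraph ω).Reachable y x} ∩ {ω | ¬ (openGraph ω).Reachable y z}), g ω ∂(prodBernoulli w)) + (∫ ω in (openConn x o ∩ openConn x y ∩ openConn x u ∩ {ω | ¬ (openGraph ω).Reachable x z}), g ω ∂(prodBernoulli w)) := by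
  classical
  set μ := prodBernoulli w with hμ
  have hmeas : ∀ S : Set (BondConfig V), MeasurableSet S := fun _ => MeasurableSet.of_discrete
  have hint : ∀ (S : Set (BondConfig V)), IntegrableOn g S μ := fun S => (Integrable.of_finite).integrableOn
  set Ax : Set (BondConfig V) := (openConn x o ∩ {ω | ¬ (openGraph ω).Reachable x y} ∩ {ω | ¬ (openGraph ω).Reachable x u} ∩ {ω | ¬ (openGraph ω).Reachable x z}) with hAx
  set Ay : Set (BondConfig V) := (openConn y o ∩ {ω | ¬ (openGraph ω).Reachable y x} ∩ {ω | ¬ (openGraph ω).Reachable y u} ∩ {ω | ¬ (openGraph ω).Reachable y z}) with hAy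
  set Au : Set (BondConfig V) := (openConn u o ∩ {ω | ¬ (openGraph ω).Reachable u x} ∩ {ω | ¬ (openGraph ω).Reachable u y} ∩ {ω | ¬ (openGraph ω).Reachable u z}) with hAu
  set Bxy : Set (BondConfig V) := (openConn x o ∩ openConn x y ∩ {ω | ¬ (openGraph ω).Reachable x u} ∩ {ω | ¬ (openGraph ω).Reachable x z}) with hBxy
  set Bxu : Set (BondConfig V) := (openConn x o ∩ openConn x u ∩ {ω | ¬ (openGraph ω).Reachable x y} ∩ {ω | ¬ (openGraph ω).Reachable x z}) with hBxu
  set Byu : Set (BondConfig V) := (openConn y o ∩ openConn y u ∩ {ω | ¬ (openGraph ω).Reachable y x} ∩ {ω | ¬ (openGraph ω).Reachable y z}) with hByu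
  set Tx : Set (BondConfig V) := (openConn x o ∩ openConn x y ∩ openConn x u ∩ {ω | ¬ (openGraph ω).Reachable x z}) with hTx
  -- patterns
  set pat : BondConfig V → Bool × Bool × Bool := fun ω =>
    (decide ((openGraph ω).Reachable o x), decide ((openGraph ω).Reachable o y), decide ((openGraph ω).Reachable o u)) with hpat
  have pdisj : ∀ {S T : Set (BondConfig V)} {a b : Bool × Bool × Bool},
      S ⊆ pat ⁻¹' {a} → T ⊆ pat ⁻¹' {b} → a ≠ b → Disjoint S T := by
    intro S T a b hS hT hab
    rw [Set.disjoint_left]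
    intro ω hωS hωT
    have h1 : pat ω = a := hS hωS
    have h2 : pat ω = b := hT hωT
    exact hab (h1.symm.trans h2)
  have pAx : Ax ⊆ pat ⁻¹' {(true, false, false)} := by
    rintro ω ⟨⟨⟨hxo, hxy'⟩, hxu⟩, _⟩
    have hox : (openGraph ω).Reachable o x := hxo.symm
    have hoy : ¬ (openGraph ω).Reachable o y := fun h => hxy' (hxo.trans h)
    have hou : ¬ (openGraph ω).Reachable o u := fun h => hxu (hxo.trans h)
    simp [hpat, hox, hoy, hou]
  have pAy : Ay ⊆ pat ⁻¹' {(false, true, false)} := by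
    rintro ω ⟨⟨⟨hyo, hyx⟩, hyu'⟩, _⟩
    have hoy : (openGraph ω).Reachable o y := hyo.symm
    have hox : ¬ (openGraph ω).Reachable o x := fun h => hyx (hyo.trans h)
    have hou : ¬ (openGraph ω).Reachable o u := fun h => hyu' (hyo.trans h)
    simp [hpat, hox, hoy, hou]
  have pAu : Au ⊆ pat ⁻¹' {(false, false, true)} := by
    rintro ω ⟨⟨⟨huo, hux⟩, huy⟩, _⟩
    have hou : (openGraph ω).Reachable o u := huo.symm
    have hox : ¬ (openGraph ω).Reachable o x := fun h => hux (huo.trans h)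
    have hoy : ¬ (openGraph ω).Reachable o y := fun h => huy (huo.trans h)
    simp [hpat, hox, hoy, hou]
  have pBxy : Bxy ⊆ pat ⁻¹' {(true, true, false)} := by
    rintro ω ⟨⟨⟨hxo, hxy'⟩, hxu⟩, _⟩
    have hox : (openGraph ω).Reachable o x := hxo.symm
    have hoy : (openGraph ω).Reachable o y := hxo.symm.trans hxy'
    have hou : ¬ (openGraph ω).Reachable o u := fun h => hxu (hxo.trans h)
    simp [hpat, hox, hoy, hou]
  have pBxu : Bxu ⊆ pat ⁻¹' {(true, false, true)} := by
    rintro ω ⟨⟨⟨hxo, hxu⟩, hxy'⟩, _⟩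
    have hox : (openGraph ω).Reachable o x := hxo.symm
    have hou : (openGraph ω).Reachable o u := hxo.symm.trans hxu
    have hoy : ¬ (openGraph ω).Reachable o y := fun h => hxy' (hxo.trans h)
    simp [hpat, hox, hoy, hou]
  have pByu : Byu ⊆ pat ⁻¹' {(false, true, true)} := by
    rintro ω ⟨⟨⟨hyo, hyu'⟩, hyx⟩, _⟩
    have hoy : (openGraph ω).Reachable o y := hyo.symm
    have hou : (openGraph ω).Reachable o u := hyo.symm.trans hyu'
    have hox : ¬ (openGraph ω).Reachable o x := fun h => hyx (hyo.trans h)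
    simp [hpat, hox, hoy, hou]
  have pTx : Tx ⊆ pat ⁻¹' {(true, true, true)} := by
    rintro ω ⟨⟨⟨hxo, hxy'⟩, hxu⟩, _⟩
    have hox : (openGraph ω).Reachable o x := hxo.symm
    have hoy : (openGraph ω).Reachable o y := hxo.symm.trans hxy'
    have hou : (openGraph ω).Reachable o u := hxo.symm.trans hxu
    simp [hpat, hox, hoy, hou]
  have d1 : Disjoint Ax Ay := pdisj pAx pAy (by decide)
  have d2 : Disjoint (Ax ∪ Ay) Au := Disjoint.union_left (pdisj pAx pAu (by decide)) (pdisj pAy pAu (by decide))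
  have d3 : Disjoint ((Ax ∪ Ay) ∪ Au) Bxy :=
    Disjoint.union_left (Disjoint.union_left (pdisj pAx pBxy (by decide)) (pdisj pAy pBxy (by decide)))
      (pdisj pAu pBxy (by decide))
  have d4 : Disjoint (((Ax ∪ Ay) ∪ Au) ∪ Bxy) Bxu :=
    Disjoint.union_left (Disjoint.union_left (Disjoint.union_left (pdisj pAx pBxu (by decide))
      (pdisj pAy pBxu (by decide))) (pdisj pAu pBxu (by decide))) (pdisj pBxy pBxu (by decide))
  have d5 : Disjoint ((((Ax ∪ Ay) ∪ Au) ∪ Bxy) ∪ Bxu) Byu :=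
    Disjoint.union_left (Disjoint.union_left (Disjoint.union_left (Disjoint.union_left
      (pdisj pAx pByu (by decide)) (pdisj pAy pByu (by decide))) (pdisj pAu pByu (by decide)))
      (pdisj pBxy pByu (by decide))) (pdisj pBxu pByu (by decide))
  have d6 : Disjoint (((((Ax ∪ Ay) ∪ Au) ∪ Bxy) ∪ Bxu) ∪ Byu) Tx :=
    Disjoint.union_left (Disjoint.union_left (Disjoint.union_left (Disjoint.union_left (Disjoint.union_left
      (pdisj pAx pTx (by decide)) (pdisj pAy pTx (by decide))) (pdisj pAu pTx (by decide)))
      (pdisj pBxy pTx (by decide))) (pdisj pBxu pTx (by decide))) (pdisj pByu pTx (by decide))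
  have hJ' : (openConn o x ∪ openConn o y ∪ openConn o u) ∩ {ω | ¬ (openGraph ω).Reachable o z} = ((((((Ax ∪ Ay) ∪ Au) ∪ Bxy) ∪ Bxu) ∪ Byu) ∪ Tx) := by
    ext ω
    simp only [hAx, hAy, hAu, hBxy, hBxu, hByu, hTx, mem_inter_iff, mem_union, mem_setOf_eq, openConn]
    constructor
    · rintro ⟨hJω, hoz⟩
      by_cases hox : (openGraph ω).Reachable o x
      · have hxz : ¬ (openGraph ω).Reachable x z := fun h => hoz (hox.trans h)
        by_cases hxy' : (openGraph ω).Reachable x y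
        · by_cases hxu : (openGraph ω).Reachable x u
          · exact Or.inr ⟨⟨⟨hox.symm, hxy'⟩, hxu⟩, hxz⟩
          · exact Or.inl (Or.inl (Or.inl (Or.inr ⟨⟨⟨hox.symm, hxy'⟩, hxu⟩, hxz⟩)))
        · by_cases hxu : (openGraph ω).Reachable x u
          · exact Or.inl (Or.inl (Or.inr ⟨⟨⟨hox.symm, hxu⟩, hxy'⟩, hxz⟩))
          · exact Or.inl (Or.inl (Or.inl (Or.inl (Or.inl (Or.inl ⟨⟨⟨hox.symm, hxy'⟩, hxu⟩, hxz⟩)))))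
      · by_cases hoy : (openGraph ω).Reachable o y
        · have hyz : ¬ (openGraph ω).Reachable y z := fun h => hoz (hoy.trans h)
          have hyx : ¬ (openGraph ω).Reachable y x := fun h => hox (hoy.trans h)
          by_cases hyu' : (openGraph ω).Reachable y u
          · exact Or.inl (Or.inr ⟨⟨⟨hoy.symm, hyu'⟩, hyx⟩, hyz⟩)
          · exact Or.inl (Or.inl (Or.inl (Or.inl (Or.inl (Or.inr ⟨⟨⟨hoy.symm, hyx⟩, hyu'⟩, hyz⟩)))))
        · have hou : (openGraph ω).Reachable o u := by
            rcases hJω with (h | h) | h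
            · exact absurd h hox
            · exact absurd h hoy
            · exact h
          have huz : ¬ (openGraph ω).Reachable u z := fun h => hoz (hou.trans h)
          have hux : ¬ (openGraph ω).Reachable u x := fun h => hox (hou.trans h)
          have huy : ¬ (openGraph ω).Reachable u y := fun h => hoy (hou.trans h)
          exact Or.inl (Or.inl (Or.inl (Or.inl (Or.inr ⟨⟨⟨hou.symm, hux⟩, huy⟩, huz⟩))))
    · rintro ((((((⟨⟨⟨hxo, _⟩, _⟩, hxz⟩ | ⟨⟨⟨hyo, _⟩, _⟩, hyz⟩) | ⟨⟨⟨huo, _⟩, _⟩, huz⟩) | ⟨⟨⟨hxo, _⟩, _⟩, hxz⟩) |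
        ⟨⟨⟨hxo, _⟩, _⟩, hxz⟩) | ⟨⟨⟨hyo, _⟩, _⟩, hyz⟩) | ⟨⟨⟨hxo, _⟩, _⟩, hxz⟩)
      · exact ⟨Or.inl (Or.inl hxo.symm), fun h => hxz (hxo.trans h)⟩
      · exact ⟨Or.inl (Or.inr hyo.symm), fun h => hyz (hyo.trans h)⟩
      · exact ⟨Or.inr huo.symm, fun h => huz (huo.trans h)⟩
      · exact ⟨Or.inl (Or.inl hxo.symm), fun h => hxz (hxo.trans h)⟩
      · exact ⟨Or.inl (Or.inl hxo.symm), fun h => hxz (hxo.trans h)⟩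
      · exact ⟨Or.inl (Or.inr hyo.symm), fun h => hyz (hyo.trans h)⟩
      · exact ⟨Or.inl (Or.inl hxo.symm), fun h => hxz (hxo.trans h)⟩
  rw [hJ', setIntegral_union d6 (hmeas _) (hint _) (hint _), setIntegral_union d5 (hmeas _) (hint _) (hint _),
    setIntegral_union d4 (hmeas _) (hint _) (hint _), setIntegral_union d3 (hmeas _) (hint _) (hint _),
    setIntegral_union d2 (hmeas _) (hint _) (hint _), setIntegral_union d1 (hmeas _) (hint _) (hint _)]

/-- A pair world seen from its two owners is the same event and the two clusters coincide there:
`∫_{y↔o, y↔x, y↮u, y↮z} g(C y) = ∫_{x↔o, x↔y, x↮u, x↮z} g(C x)` for any `g` on vertex sets. [folklore] -/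
theorem integral_pairWorld_swap (w : Sym2 V → unitInterval) (o x y u z : V) (g : Set V → ℝ) :
    ∫ ω in (openConn y o ∩ openConn y x ∩ {ω | ¬ (openGraph ω).Reachable y u} ∩ {ω | ¬ (openGraph ω).Reachable y z}), g (openCluster ω y) ∂(prodBernoulli w) =
      ∫ ω in (openConn x o ∩ openConn x y ∩ {ω | ¬ (openGraph ω).Reachable x u} ∩ {ω | ¬ (openGraph ω).Reachable x z}), g (openCluster ω x) ∂(prodBernoulli w) := by
  have e : (openConn y o ∩ openConn y x ∩ {ω | ¬ (openGraph ω).Reachable y u} ∩ {ω | ¬ (openGraph ω).Reachable y z}) = ((openConn x o ∩ openConn x y ∩ {ω | ¬ (openGraph ω).Reachable x u} ∩ {ω | ¬ (openGraph ω).Reachable x z}) : Set (BondConfig V)) := by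
    ext ω; simp only [mem_inter_iff, openConn, mem_setOf_eq]
    constructor
    · rintro ⟨⟨⟨hyo, hyx⟩, hyu⟩, hyz⟩
      exact ⟨⟨⟨hyx.symm.trans hyo, hyx.symm⟩, fun h => hyu (hyx.trans h)⟩, fun h => hyz (hyx.trans h)⟩
    · rintro ⟨⟨⟨hxo, hxy'⟩, hxu⟩, hxz⟩
      exact ⟨⟨⟨hxy'.symm.trans hxo, hxy'.symm⟩, fun h => hxu (hxy'.trans h)⟩, fun h => hxz (hxy'.trans h)⟩
  rw [e]
  exact setIntegral_congr_fun MeasurableSet.of_discrete fun ω hω => by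
    rw [openCluster_eq_of_reachable (show (openGraph ω).Reachable x y from hω.1.1.2)]

omit [Fintype V] in
/-- Same pair world, an integrand not depending on the owner: the two events are equal. [folklore] -/
theorem integral_pairWorld_swap' (w : Sym2 V → unitInterval) (o x y u z : V) (g : BondConfig V → ℝ) :
    ∫ ω in (openConn y o ∩ openConn y x ∩ {ω | ¬ (openGraph ω).Reachable y u} ∩ {ω | ¬ (openGraph ω).Reachable y z}), g ω ∂(prodBernoulli w) = ∫ ω in (openConn x o ∩ openConn x y ∩ {ω | ¬ (openGraph ω).Reachable x u} ∩ {ω | ¬ (openGraph ω).Reachable x z}), g ω ∂(prodBernoulli w) := by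
  have e : (openConn y o ∩ openConn y x ∩ {ω | ¬ (openGraph ω).Reachable y u} ∩ {ω | ¬ (openGraph ω).Reachable y z}) = ((openConn x o ∩ openConn x y ∩ {ω | ¬ (openGraph ω).Reachable x u} ∩ {ω | ¬ (openGraph ω).Reachable x z}) : Set (BondConfig V)) := by
    ext ω; simp only [mem_inter_iff, openConn, mem_setOf_eq]
    constructor
    · rintro ⟨⟨⟨hyo, hyx⟩, hyu⟩, hyz⟩
      exact ⟨⟨⟨hyx.symm.trans hyo, hyx.symm⟩, fun h => hyu (hyx.trans h)⟩, fun h => hyz (hyx.trans h)⟩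
    · rintro ⟨⟨⟨hxo, hxy'⟩, hxu⟩, hxz⟩
      exact ⟨⟨⟨hxy'.symm.trans hxo, hxy'.symm⟩, fun h => hxu (hxy'.trans h)⟩, fun h => hxz (hxy'.trans h)⟩
  rw [e]

/-- The triple world seen from owner `y` is the triple world of owner `x`, and the clusters coincide. [folklore] -/
theorem integral_tripleWorld_swap (w : Sym2 V → unitInterval) (o x y u z : V) (g : Set V → ℝ) :
    ∫ ω in (openConn y o ∩ openConn y x ∩ openConn y u ∩ {ω | ¬ (openGraph ω).Reachable y z}), g (openCluster ω y) ∂(prodBernoulli w) =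
      ∫ ω in (openConn x o ∩ openConn x y ∩ openConn x u ∩ {ω | ¬ (openGraph ω).Reachable x z}), g (openCluster ω x) ∂(prodBernoulli w) := by
  have e : (openConn y o ∩ openConn y x ∩ openConn y u ∩ {ω | ¬ (openGraph ω).Reachable y z}) = ((openConn x o ∩ openConn x y ∩ openConn x u ∩ {ω | ¬ (openGraph ω).Reachable x z}) : Set (BondConfig V)) := by
    ext ω; simp only [mem_inter_iff, openConn, mem_setOf_eq]
    constructor
    · rintro ⟨⟨⟨hyo, hyx⟩, hyu⟩, hyz⟩
      exact ⟨⟨⟨hyx.symm.trans hyo, hyx.symm⟩, hyx.symm.trans hyu⟩, fun h => hyz (hyx.trans h)⟩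
    · rintro ⟨⟨⟨hxo, hxy'⟩, hxu⟩, hxz⟩
      exact ⟨⟨⟨hxy'.symm.trans hxo, hxy'.symm⟩, hxy'.symm.trans hxu⟩, fun h => hxz (hxy'.trans h)⟩
  rw [e]
  exact setIntegral_congr_fun MeasurableSet.of_discrete fun ω hω => by
    rw [openCluster_eq_of_reachable (show (openGraph ω).Reachable x y from hω.1.1.2)]

omit [Fintype V] in
/-- Triple world, owner-independent integrand. [folklore] -/
theorem integral_tripleWorld_swap' (w : Sym2 V → unitInterval) (o x y u z : V) (g : BondConfig V → ℝ) :
    ∫ ω in (openConn y o ∩ openConn y x ∩ openConn y u ∩ {ω | ¬ (openGraph ω).Reachable y z}), g ω ∂(prodBernoulli w) = ∫ ω in (openConn x o ∩ openConn x y ∩ openConn x u ∩ {ω | ¬ (openGraph ω).Reachable x z}), g ω ∂(prodBernoulli w) := by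
  have e : (openConn y o ∩ openConn y x ∩ openConn y u ∩ {ω | ¬ (openGraph ω).Reachable y z}) = ((openConn x o ∩ openConn x y ∩ openConn x u ∩ {ω | ¬ (openGraph ω).Reachable x z}) : Set (BondConfig V)) := by
    ext ω; simp only [mem_inter_iff, openConn, mem_setOf_eq]
    constructor
    · rintro ⟨⟨⟨hyo, hyx⟩, hyu⟩, hyz⟩
      exact ⟨⟨⟨hyx.symm.trans hyo, hyx.symm⟩, hyx.symm.trans hyu⟩, fun h => hyz (hyx.trans h)⟩
    · rintro ⟨⟨⟨hxo, hxy'⟩, hxu⟩, hxz⟩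
      exact ⟨⟨⟨hxy'.symm.trans hxo, hxy'.symm⟩, hxy'.symm.trans hxu⟩, fun h => hxz (hxy'.trans h)⟩
  rw [e]

/-- The triple world of owner `u` (listing `x` before `y`) is the triple world of owner `x`. [folklore] -/
theorem integral_tripleWorld_swap_u (w : Sym2 V → unitInterval) (o x y u z : V) (g : Set V → ℝ) :
    ∫ ω in (openConn u o ∩ openConn u x ∩ openConn u y ∩ {ω | ¬ (openGraph ω).Reachable u z}), g (openCluster ω u) ∂(prodBernoulli w) =
      ∫ ω in (openConn x o ∩ openConn x y ∩ openConn x u ∩ {ω | ¬ (openGraph ω).Reachable x z}), g (openCluster ω x) ∂(prodBernoulli w) := by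
  have e : (openConn u o ∩ openConn u x ∩ openConn u y ∩ {ω | ¬ (openGraph ω).Reachable u z}) = ((openConn x o ∩ openConn x y ∩ openConn x u ∩ {ω | ¬ (openGraph ω).Reachable x z}) : Set (BondConfig V)) := by
    ext ω; simp only [mem_inter_iff, openConn, mem_setOf_eq]
    constructor
    · rintro ⟨⟨⟨huo, hux⟩, huy⟩, huz⟩
      exact ⟨⟨⟨hux.symm.trans huo, hux.symm.trans huy⟩, hux.symm⟩, fun h => huz (hux.trans h)⟩
    · rintro ⟨⟨⟨hxo, hxy'⟩, hxu⟩, hxz⟩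
      exact ⟨⟨⟨hxu.symm.trans hxo, hxu.symm⟩, hxu.symm.trans hxy'⟩, fun h => hxz (hxu.trans h)⟩
  rw [e]
  exact setIntegral_congr_fun MeasurableSet.of_discrete fun ω hω => by
    rw [openCluster_eq_of_reachable (show (openGraph ω).Reachable x u from hω.1.2)]

omit [Fintype V] in
/-- Triple world of owner `u`, owner-independent integrand. [folklore] -/
theorem integral_tripleWorld_swap_u' (w : Sym2 V → unitInterval) (o x y u z : V) (g : BondConfig V → ℝ) :
    ∫ ω in (openConn u o ∩ openConn u x ∩ openConn u y ∩ {ω | ¬ (openGraph ω).Reachable u z}), g ω ∂(prodBernoulli w) = ∫ ω in (openConn x o ∩ openConn x y ∩ openConn x u ∩ {ω | ¬ (openGraph ω).Reachable x z}), g ω ∂(prodBernoulli w) := by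
  have e : (openConn u o ∩ openConn u x ∩ openConn u y ∩ {ω | ¬ (openGraph ω).Reachable u z}) = ((openConn x o ∩ openConn x y ∩ openConn x u ∩ {ω | ¬ (openGraph ω).Reachable x z}) : Set (BondConfig V)) := by
    ext ω; simp only [mem_inter_iff, openConn, mem_setOf_eq]
    constructor
    · rintro ⟨⟨⟨huo, hux⟩, huy⟩, huz⟩
      exact ⟨⟨⟨hux.symm.trans huo, hux.symm.trans huy⟩, hux.symm⟩, fun h => huz (hux.trans h)⟩
    · rintro ⟨⟨⟨hxo, hxy'⟩, hxu⟩, hxz⟩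
      exact ⟨⟨⟨hxu.symm.trans hxo, hxu.symm⟩, hxu.symm.trans hxy'⟩, fun h => hxz (hxu.trans h)⟩
  rw [e]

end Q7Psi

end

end Summit.CriticalPhenomena.PercolationContinuityZ3.Theorems
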